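import Literature.NumberTheory.EllipticCurves.CongruenceNumber
import Literature.NumberTheory.EllipticCurves.GlobalMinimalModel
import Literature.NumberTheory.EllipticCurves.GaloisAction
import Literature.NumberTheory.DiophantineGeometry.Conductor
import Literature.NumberTheory.DiophantineGeometry.TateAlgorithm
import Literature.NumberTheory.DiophantineGeometry.KodairaSymbol
import Mathlib.NumberTheory.Padics.HeightOneSpectrum
import HarnessLib
import HarnessLib.Audit.Tags

/-!
# Candidates E-desc-14, 14♭, 15, 16, 17, 18 of cell `bsd-f2-manin` (D-0131 (3) frontier: the
# Manin constant at additive primes): the CONGRUENCE-EXCESS laws — the excess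
# `x_p(E) = ord_p(r_E) − ord_p(m_E)` of the `X₀(N)`-optimal curve is a function of
# (`ord_p(N)`, Kodaira type at `p`, irreducibility of `E[p]`). `@[conjecture]` leaves (NOTHING
# asserted; definitions only; the proved placement edges live in the sibling
# `CongruenceExcessLawsEdges.lean`).

HONEST FRAMING. LENS = descent / visibility (planner `bsd-f2-manin-desc` g2, HOME
`run/shared/lean/pub/bsd-f2-manin/MEMO-desc.md` §19; decls VERBATIM from HOME
`desc/Sketch-desc-g2.lean` sha16 2249256900ee85ff, farm rc 0 · 0 warnings · 0 sorries, with its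
three helper definitions INLINED so that this leaf declares conjectures only:
`kodairaAtPrime W p hp ↦ W.kodairaSymbolAt ((Rat.HeightOneSpectrum.primesEquiv (R := ℤ)).symm ⟨p, hp⟩)`
(Tate's algorithm at the place `(p)` of `ℤ`), `IsRigidKodaira K ↦ (K = II* ∨ K = III* ∨ K = IV* ∨
∃ n ≠ 0, K = Iₙ*)`, `rigidDyadicExcess v ↦ v / 2 − 1` (natural-number division and subtraction:
values `0,0,1,1,2,2,3` for `v = 2,…,8`)). For the `X₀(N)`-optimal curve `E` with newform `f` write
`r_E = congruenceNumber f`, `m_E = deg φ₀ = D.modularDegree`, `x_p(E) = ord_p(r_E) − ord_p(m_E) ≥ 0`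
(`m_E ∣ r_E`, Agashe–Ribet–Stein 2012 Thm. 2.1 = tree fact `modularDegree_dvd_congruenceNumber`;
`x_p = 0` when `p² ∤ N`, ibid. = tree fact `padicValNat_congruenceNumber_eq_of_not_sq_dvd`; the
printed CEILING `x_p ≤ ⌊ord_p(N)/2⌋` is ARS 2012 Conj. 2.2 = tree `@[conjecture]`
`AgasheRibetStein2012_conjecture`, OPEN, verified in print for `N ≤ 557`). The memo's lattice
identity (††) `ord_p(c_E) = t_p − a_p − x_p(E)` (MEMO-desc §1, the cell's own bookkeeping, a variant
of Česnavičius 2016 §2 at square primes — not print) turns every law for `x_p` into a law for the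
Manin valuation plus the `f`-line gap `t_p` between the `q`-expansion lattice `S₂(Γ₀(N), ℤ_p)` and
the Néron lattice `H⁰(J₀(N)_{ℤ_p}, Ω¹)`. "Rigid" Kodaira types = `Iₙ*` (`n ≥ 1`), `II*`, `III*`, `IV*`
(the large-discriminant side of the ramified quadratic twist at a tame additive prime); the
complementary types `II`, `III`, `IV`, `I₀*` contain Edixhoven's exceptional list (Edixhoven 1991
Thm. 3: potentially ORDINARY `II/III/IV` at `p > 7`; `I₀*` is not an exception there).

NOT IN PRINT (refuter-2 g5, R-desc-5 placement 2026-08-27T19:43Z, HOME `ref2/…-v6` §Q⁶ sha16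
5a2e6b9e9e0d3d7b): no Kodaira-resolved statement on `r_E/m_E` exists in print (corpus + galaxy:
ARS 2012 Thm. 2.1 / Conj. 2.2 / Prop. 2.3 + Table 1; Cojocaru–Kani 2004 Thm. 1.1 `deg φ_f ∣ D_f`
without local refinement; the announced sequel [AgSt2] never appeared); nothing conditions `x_p`
on Kodaira type, `E[p]` or `ord_p(N)`. Row verdicts: E-desc-14 SPLIT — its Manin conjunct at
`p > 7` on the rigid stratum IS print (Edixhoven 1991 Thm. 3 + Mazur–Stevens = tree fact
`edixhoven_not_dvd_maninConstant_of_kodairaSymbol_ne`; proved edge in the sibling file), the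
`p ≤ 7` Manin conjunct and `x_p = 0` NOT in print (decides Conj. 2.2's `{0,1}` on the rigid
stratum); E-desc-15 NOT in print (one below the ARS ceiling; a mod-`2` twist-congruence mechanism
is qualitatively in print — refuter-2: «CE09 / Yazdani Thm. 2.10 / KK18» — the exact value is not);
E-desc-16 NOT in print (inside `x₃ ≤ 1` it says which; 54B1/108A1/135A1 of ARS Table 1
consistent); E-desc-17 NOT in print (`2 ∤ c_E` for `II*/III*/IV*` at `2` nowhere in print);
E-desc-18 NOT in print (equality on a stratum of an open conjecture; via ARS 2012 Prop. 2.3 it is a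
multiplicity-one-FAILURE law at the irreducible `𝔪_E` of residue characteristic `p`, `p² ∥ N`,
answering the printed request ARS 2012 p. 5 «it would be interesting to do computations … to see
if the completion … is Gorenstein or not»; no multiplicity-one / Gorenstein dichotomy by local type
at `p² ∥ N` is in print — Mazur 1977 prime level, Mazur–Ribet Astérisque 196–197 `p ∥ N`,
Kilford 2002 / Kilford–Wiese 2008 `p = 2`). All five: data laws, new in statement, none refuted in
print, none a Literature fact; beyond-print theorem: NO (conjectures). PARTITION 0.

BC5 WITNESSES (two independent engines, 0 violations at every bound).
(1) Planner census HOME `desc/congr-census-v1.tsv` sha16 2c2b6fde6c4488d1 (engine HOME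
`desc/congr-engine/` = PARI `mfinit` + integral `q`-expansion lattice + saturation, validated on ARS
2012 Table 1, 23/23 rows): 3785 `(class, p)` incidences with `p² ∣ N` over 3015 optimal classes,
`N ≤ 3888` (525 of the 637 non-squarefree levels `N ≤ 2000` carrying an optimal class, plus the
deeper levels 2025, 2106, 2268, 2304, 2430, 2592, 2754, 2835, 3328, 3840, 3888): E-desc-14/14♭
`x_p = 0` in 1063/1063 incidences (`p = 2`: 180, `p = 3`: 404, `p ≥ 5`: 479; `c_E ≡ 1` in range,
Cremona); E-desc-15 = E-desc-17-data 380/380 (`ord₂(N) = 2,…,8`); E-desc-16 171/171 + 119/119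
(`N ≤ 1971`; only the four types occur at `27 ∥ N`); E-desc-18 335/335 (`p ≥ 5`: 248/248; `p = 3`,
type III: 87/87); ARS Conj. 2.2 3785/3785 IN CENSUS v1 (which lacked 112 levels, among them 1664), its
ceiling ATTAINED at `ord₂(N) = 8`, `N = 3328` (`x₂ = 4`, type III, 6 classes) — so the rigid dyadic law is
stated with `⌊v/2⌋ − 1`, not with a type-free ceiling. ADDENDUM (finding F-desc-ARS, planner 2026-08-27T21:42Z,
CONFIRMED by refuter-1's independent third engine §R32 22:14Z, 26/26 to the digit; refuter-2 v7 §K⁷: «REFUTED —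
BEYOND PRINT»): in the COMPLETE census v1.1 (all 637 non-squarefree `N ≤ 2000` + 11 deeper levels, 4555
incidences) ARS Conj. 2.2 FAILS on exactly 26 optimal curves — `(ord₂(N), type at 2, E[2]) = (7, II,
irreducible)`, `x₂ = 4 > 7/2`, at `N = 1664, 2432, 3200, 3456` (smallest 1664b1: `r_E = 1536`, `m_E = 96`);
the five laws of THIS file are unaffected (rigid types only; 4555-row recheck in the sibling leaf
`CongruenceExcessCeilingLaws.lean`, rows E-desc-19/20/21, where the repaired ceiling `⌈ord_p(N)/2⌉` and the
Lean currency of the finding — `not_agasheRibetStein2012_conjecture_of_typeTwo`, a negative lemma modulo one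
witness datum — live). RESTATEMENT 2026-08-27T18:55Z of E-desc-14: without the irreducibility proviso
on `Iₙ*` the law has exactly one exception in 1109 incidences — `1953g1` (`p = 3`, `I₉*`, rational
`9`-isogeny, `r_E = 2304`, `m_E = 768`, `x₃ = 1`; single engine, flagged for the second engine
D-desc-4); the reducible-`Iₙ*` cell (46 incidences, `x = 0` in all but that one) is recorded, not
typed. (2) Refuter-1 g2 INDEPENDENT engine (R-desc-5 verdict 2026-08-27T20:57Z, HOME
`REFUTER-ref1.md` §R20 sha16 0df793b66e17baeb; PARI full space `S₂(Γ₀(N))` + Sturm + `ℤ`-saturation,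
v2/v4/v5/v7 agreeing on 1987 cross-computed labels, ARS Table 1 23/23, `deg ∣ r_f` everywhere) →
HOME `ref1/R20-congruence-numbers-N1500.tsv` sha16 ba6d03ba11e9c6b4: 3579 optimal curves,
LAW-COMPLETE for every level with a square factor `N ≤ 1268`, partial to 1500: E-desc-14/14♭
713/713 (and `x_p = 0` in all 52 reducible-`Iₙ*` incidences `N ≤ 1500`), E-desc-15/17-data
266/266 (277/277 with the partial range; `ord₂(N) = 8` carries only type III below 1500),
E-desc-16 101 + 74, E-desc-18 191/191, at `N ≤ 1268` — all five SURVIVE (KILLED 0/5; A1 rc 0,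
BC7 2/2 CLEAN, HOME `ref1-C37-desc-g2-probes.lean`); by-product: ARS Conj. 2.2 holds on every
optimal curve of THAT table (all `N ≤ 1268` with a square factor, all `N ≤ 700`; printed verification
was `N ≤ 557`) — and first fails at `N = 1664` (ADDENDUM above). Rows E-desc-14…18 of HOME `CANDIDATES.md`.

RENDERING (refuter-1 traps T1–T3, T7 respected; same binder shape as `ManinCongruenceDefectLaw`,
`InertialTorusLawTwo`, `AgasheRibetStein2012_conjecture`): globally minimal `W`, datum `D` at the
CONDUCTOR level `N = W.conductorNorm ℤ`, the lattice clause `Λ_W = c·Λ_f` (`φ_D` optimal,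
`|D.c| = c_E = |D.maninConstant|`) AND the minimal-degree clause (`D.deg = m_E`: minimal among all
data at level `N`, of all elliptic `W'`, with the same newform), so that `congruenceNumber D.f = r_E`
and `D.modularDegree = m_E`; Kodaira symbols by `WeierstrassCurve.kodairaSymbolAt` at the place
`primesEquiv.symm ⟨p, hp⟩`; `E[p]` irreducible = `WeierstrassCurve.HasIrreducibleModPGaloisRep p`;
all valuations `padicValNat`, equalities cleared of natural-number subtraction except the dyadic
excess `ord₂(N) / 2 - 1` (which is the sketch's `rigidDyadicExcess`, `ℕ`-valued by design: at
`ord₂(N) ∈ {2, 3}` it is `0`).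
-/

noncomputable section

open scoped MatrixGroups ModularForm

open CongruenceSubgroup WeierstrassCurve
  Literature.NumberTheory.EllipticCurves Literature.NumberTheory.EllipticCurves.ModularForms
  Literature.NumberTheory.DiophantineGeometry

namespace Summit.BirchSwinnertonDyer.Rank1Residual.ManinAdditive

/-- **Candidate E-desc-14 `TameRigidManinLaw`** (a CONJECTURE of the cell; nothing asserted).
For the `X₀(N)`-optimal `E` (lattice clause + minimal degree at level `N = conductor`) and a prime
`p` with `v_p(N) = 2` and RIGID Kodaira type at `p` — `II*`, `III*`, `IV*` unconditionally, `Iₙ*`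
(`n ≥ 1`) provided `E[p]` is irreducible — : `p ∤ c_E` and `v_p(r_E) = v_p(m_E)`.
By (††) this is the typed avatar of the GAP LAW `t_p = a_p` (the `q`-expansion lattice and the
Néron lattice project to the same `ℤ_p`-line through `f`, up to the cotangent cokernel).
Census: `x_p = 0` in 1063/1063 incidences (p = 2: 180, p = 3: 404, p ≥ 5: 479; N ≤ 3888), c ≡ 1;
refuter-1's independent engine 713/713 (N ≤ 1268, law-complete).
RESTATED 2026-08-27T18:55Z: without the irreducibility proviso on `Iₙ*` the law has exactly one
exception in 1109 incidences — `1953g1` (`p = 3`, `I₉*`, rational `9`-isogeny, `r_E = 2304`,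
`m_E = 768`, `x₃ = 1`; single engine, flagged for the second engine D-desc-4); the reducible-`Iₙ*`
cell (46 incidences, `x = 0` in all but that one) is recorded, not typed. The Manin conjunct at
`p > 7` is in print (Edixhoven 1991 Thm. 3 with Mazur–Stevens: tree fact
`edixhoven_not_dvd_maninConstant_of_kodairaSymbol_ne`; proved edge
`tameRigid_not_dvd_maninConstant_of_edixhoven` in the sibling file); the rest is NOT in print.
[cite: AgasheRibetStein2012, Thm. 2.1 and Conj. 2.2 (shape and ceiling only: print gives m_E ∣ r_E, ord_p(r_E) = ord_p(m_E) for ord_p(N) ≤ 1, and conjectures ord_p(r_E/m_E) ≤ ord_p(N)/2; the Kodaira-resolved law is NOT in print — cell bsd-f2-manin MEMO-desc.md §19, E-desc-14; refuter-2 v6 §Q⁶)] -/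
@[conjecture] def TameRigidManinLaw : Prop :=
  ∀ (W : WeierstrassCurve ℚ) [W.IsElliptic] [W.IsGloballyMinimal] [NeZero (W.conductorNorm ℤ)]
    (D : ModularParametrizationData W (W.conductorNorm ℤ)),
    (∀ z ∈ D.L.lattice, ∃ w ∈ periodLattice D.f, z = D.c * w) →
    (∀ (W' : WeierstrassCurve ℚ) [W'.IsElliptic]
        (D' : ModularParametrizationData W' (W.conductorNorm ℤ)),
        D'.f = D.f → D.modularDegree ≤ D'.modularDegree) →
    ∀ (p : ℕ) (hp : p.Prime), padicValNat p (W.conductorNorm ℤ) = 2 →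
      (W.kodairaSymbolAt ((Rat.HeightOneSpectrum.primesEquiv (R := ℤ)).symm ⟨p, hp⟩) =
          KodairaSymbol.IIstar ∨
        W.kodairaSymbolAt ((Rat.HeightOneSpectrum.primesEquiv (R := ℤ)).symm ⟨p, hp⟩) =
          KodairaSymbol.IIIstar ∨
        W.kodairaSymbolAt ((Rat.HeightOneSpectrum.primesEquiv (R := ℤ)).symm ⟨p, hp⟩) =
          KodairaSymbol.IVstar ∨
        ∃ n, n ≠ 0 ∧
          W.kodairaSymbolAt ((Rat.HeightOneSpectrum.primesEquiv (R := ℤ)).symm ⟨p, hp⟩) =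
            KodairaSymbol.Istar n) →
      ((∃ n, W.kodairaSymbolAt ((Rat.HeightOneSpectrum.primesEquiv (R := ℤ)).symm ⟨p, hp⟩) =
          KodairaSymbol.Istar n) → W.HasIrreducibleModPGaloisRep p) →
      ¬ (p : ℤ) ∣ D.maninConstant ∧
        padicValNat p (congruenceNumber D.f) = padicValNat p D.modularDegree

/-- **Candidate E-desc-14♭ `TameRigidNoExcess`** (the data-visible half of E-desc-14; a CONJECTURE,
nothing asserted): `v_p(N) = 2`, rigid type at `p` (`II*`, `III*`, `IV*`, or `Iₙ*` with `n ≥ 1`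
and then `E[p]` irreducible) ⇒ `v_p(r_E) = v_p(m_E)`. Census 1063/1063 (planner, N ≤ 3888) and
713/713 (refuter-1's independent engine, N ≤ 1268 law-complete). Edge (sibling file):
`TameRigidManinLaw → TameRigidNoExcess`.
[cite: AgasheRibetStein2012, Thm. 2.1 and Conj. 2.2 (shape and ceiling only; the Kodaira-resolved value x_p = 0 on the rigid stratum is NOT in print — cell bsd-f2-manin MEMO-desc.md §19, E-desc-14♭; refuter-2 v6 §Q⁶)] -/
@[conjecture] def TameRigidNoExcess : Prop :=
  ∀ (W : WeierstrassCurve ℚ) [W.IsElliptic] [W.IsGloballyMinimal] [NeZero (W.conductorNorm ℤ)]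
    (D : ModularParametrizationData W (W.conductorNorm ℤ)),
    (∀ z ∈ D.L.lattice, ∃ w ∈ periodLattice D.f, z = D.c * w) →
    (∀ (W' : WeierstrassCurve ℚ) [W'.IsElliptic]
        (D' : ModularParametrizationData W' (W.conductorNorm ℤ)),
        D'.f = D.f → D.modularDegree ≤ D'.modularDegree) →
    ∀ (p : ℕ) (hp : p.Prime), padicValNat p (W.conductorNorm ℤ) = 2 →
      (W.kodairaSymbolAt ((Rat.HeightOneSpectrum.primesEquiv (R := ℤ)).symm ⟨p, hp⟩) =
          KodairaSymbol.IIstar ∨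
        W.kodairaSymbolAt ((Rat.HeightOneSpectrum.primesEquiv (R := ℤ)).symm ⟨p, hp⟩) =
          KodairaSymbol.IIIstar ∨
        W.kodairaSymbolAt ((Rat.HeightOneSpectrum.primesEquiv (R := ℤ)).symm ⟨p, hp⟩) =
          KodairaSymbol.IVstar ∨
        ∃ n, n ≠ 0 ∧
          W.kodairaSymbolAt ((Rat.HeightOneSpectrum.primesEquiv (R := ℤ)).symm ⟨p, hp⟩) =
            KodairaSymbol.Istar n) →
      ((∃ n, W.kodairaSymbolAt ((Rat.HeightOneSpectrum.primesEquiv (R := ℤ)).symm ⟨p, hp⟩) =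
          KodairaSymbol.Istar n) → W.HasIrreducibleModPGaloisRep p) →
      padicValNat p (congruenceNumber D.f) = padicValNat p D.modularDegree

/-- **Candidate E-desc-15 `DyadicRigidExcessLaw`** (a CONJECTURE of the cell; nothing asserted).
Optimal `E`, Kodaira type `II*`, `III*` or `IV*` at `2` ⇒ `v₂(r_E) = v₂(m_E) + ⌊v₂(N)/2⌋ − 1`
(the rigid dyadic types sit EXACTLY one below the Agashe–Ribet–Stein ceiling `⌊v₂(N)/2⌋`; the
excess `⌊v/2⌋ − 1` takes the values `0,0,1,1,2,2,3` for `v = 2,…,8`, natural-number arithmetic).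
Census: 380/380 (v₂(N) = 2,…,8; N ≤ 3888); refuter-1's independent engine 266/266 (N ≤ 1268);
via (††): `t₂ − a₂ − ord₂(c_E) = ⌊v/2⌋ − 1`. NOT in print (a mod-`2` twist-congruence mechanism is
qualitatively in print, the exact value is not). Edge (sibling file):
`DyadicRigidManinLaw → DyadicRigidExcessLaw`.
[cite: AgasheRibetStein2012, Conj. 2.2 (ceiling only: ord₂(r_E/m_E) ≤ ord₂(N)/2; the exact value one below the ceiling on the rigid dyadic types is NOT in print — cell bsd-f2-manin MEMO-desc.md §19, E-desc-15; refuter-2 v6 §Q⁶)] -/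
@[conjecture] def DyadicRigidExcessLaw : Prop :=
  ∀ (W : WeierstrassCurve ℚ) [W.IsElliptic] [W.IsGloballyMinimal] [NeZero (W.conductorNorm ℤ)]
    (D : ModularParametrizationData W (W.conductorNorm ℤ)),
    (∀ z ∈ D.L.lattice, ∃ w ∈ periodLattice D.f, z = D.c * w) →
    (∀ (W' : WeierstrassCurve ℚ) [W'.IsElliptic]
        (D' : ModularParametrizationData W' (W.conductorNorm ℤ)),
        D'.f = D.f → D.modularDegree ≤ D'.modularDegree) →
    (W.kodairaSymbolAt ((Rat.HeightOneSpectrum.primesEquiv (R := ℤ)).symm ⟨2, Nat.prime_two⟩) =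
        KodairaSymbol.IIstar ∨
      W.kodairaSymbolAt ((Rat.HeightOneSpectrum.primesEquiv (R := ℤ)).symm ⟨2, Nat.prime_two⟩) =
        KodairaSymbol.IIIstar ∨
      W.kodairaSymbolAt ((Rat.HeightOneSpectrum.primesEquiv (R := ℤ)).symm ⟨2, Nat.prime_two⟩) =
        KodairaSymbol.IVstar) →
      padicValNat 2 (congruenceNumber D.f) =
        padicValNat 2 D.modularDegree + (padicValNat 2 (W.conductorNorm ℤ) / 2 - 1)

/-- **Candidate E-desc-16 `CubeLevelThreeExcessLaw`** (a CONJECTURE of the cell; nothing asserted).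
Optimal `E` with `v₃(N) = 3`: type `II` or `IV` at `3` ⇒ `v₃(r_E) = v₃(m_E) + 1`; type `II*` or
`IV*` ⇒ `v₃(r_E) = v₃(m_E)`. Census: 171/171 and 119/119 (N ≤ 1971; only these four types occur
at `27 ∥ N`); refuter-1's independent engine 101 + 74 (N ≤ 1268). NOT in print (inside the printed
ceiling `x₃ ≤ 1` it says which; 54B1, 108A1, 135A1 of ARS 2012 Table 1 are consistent).
[cite: AgasheRibetStein2012, Conj. 2.2 and Table 1 (ceiling only: ord₃(r_E/m_E) ≤ 1 at 27 ∥ N; the Kodaira-resolved value is NOT in print — cell bsd-f2-manin MEMO-desc.md §19, E-desc-16; refuter-2 v6 §Q⁶)] -/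
@[conjecture] def CubeLevelThreeExcessLaw : Prop :=
  ∀ (W : WeierstrassCurve ℚ) [W.IsElliptic] [W.IsGloballyMinimal] [NeZero (W.conductorNorm ℤ)]
    (D : ModularParametrizationData W (W.conductorNorm ℤ)),
    (∀ z ∈ D.L.lattice, ∃ w ∈ periodLattice D.f, z = D.c * w) →
    (∀ (W' : WeierstrassCurve ℚ) [W'.IsElliptic]
        (D' : ModularParametrizationData W' (W.conductorNorm ℤ)),
        D'.f = D.f → D.modularDegree ≤ D'.modularDegree) →
    padicValNat 3 (W.conductorNorm ℤ) = 3 →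
      ((W.kodairaSymbolAt
              ((Rat.HeightOneSpectrum.primesEquiv (R := ℤ)).symm ⟨3, Nat.prime_three⟩) =
            KodairaSymbol.II ∨
          W.kodairaSymbolAt
              ((Rat.HeightOneSpectrum.primesEquiv (R := ℤ)).symm ⟨3, Nat.prime_three⟩) =
            KodairaSymbol.IV) →
          padicValNat 3 (congruenceNumber D.f) = padicValNat 3 D.modularDegree + 1) ∧
        ((W.kodairaSymbolAt
              ((Rat.HeightOneSpectrum.primesEquiv (R := ℤ)).symm ⟨3, Nat.prime_three⟩) =
            KodairaSymbol.IIstar ∨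
          W.kodairaSymbolAt
              ((Rat.HeightOneSpectrum.primesEquiv (R := ℤ)).symm ⟨3, Nat.prime_three⟩) =
            KodairaSymbol.IVstar) →
          padicValNat 3 (congruenceNumber D.f) = padicValNat 3 D.modularDegree)

/-- **Candidate E-desc-17 `DyadicRigidManinLaw`** (a CONJECTURE of the cell; nothing asserted;
the `2`-adic analogue of E-desc-14 and a sharpening BY ONE of E-desc-2 `ManinCongruenceDefectLaw`
on the rigid dyadic types).  Optimal `E` with Kodaira type `II*`, `III*` or `IV*` at `2` ⇒
`2 ∤ c_E` and `v₂(r_E) = v₂(m_E) + ⌊v₂(N)/2⌋ − 1`; via (††): the `f`-line gap `t₂ − a₂` equals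
`⌊v₂(N)/2⌋ − 1`.  Census (c ≡ 1 in range): 380/380; refuter-1's independent engine 266/266.
NOT in print (`2 ∤ c_E` for `II*/III*/IV*` at `2` is nowhere in print). Edges (sibling file):
`DyadicRigidManinLaw → DyadicRigidExcessLaw`, and on a rigid dyadic optimal curve with
`v₂(N) ≥ 2` it gives `ManinCongruenceDefectLaw`'s inequality at `p = 2` with slack two.
[cite: AgasheRibetStein2012, Conj. 2.2 (ceiling only; neither the Manin conjunct 2 ∤ c_E on the rigid dyadic types nor the exact excess is in print — cell bsd-f2-manin MEMO-desc.md §19, E-desc-17; refuter-2 v6 §Q⁶)] -/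
@[conjecture] def DyadicRigidManinLaw : Prop :=
  ∀ (W : WeierstrassCurve ℚ) [W.IsElliptic] [W.IsGloballyMinimal] [NeZero (W.conductorNorm ℤ)]
    (D : ModularParametrizationData W (W.conductorNorm ℤ)),
    (∀ z ∈ D.L.lattice, ∃ w ∈ periodLattice D.f, z = D.c * w) →
    (∀ (W' : WeierstrassCurve ℚ) [W'.IsElliptic]
        (D' : ModularParametrizationData W' (W.conductorNorm ℤ)),
        D'.f = D.f → D.modularDegree ≤ D'.modularDegree) →
    (W.kodairaSymbolAt ((Rat.HeightOneSpectrum.primesEquiv (R := ℤ)).symm ⟨2, Nat.prime_two⟩) =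
        KodairaSymbol.IIstar ∨
      W.kodairaSymbolAt ((Rat.HeightOneSpectrum.primesEquiv (R := ℤ)).symm ⟨2, Nat.prime_two⟩) =
        KodairaSymbol.IIIstar ∨
      W.kodairaSymbolAt ((Rat.HeightOneSpectrum.primesEquiv (R := ℤ)).symm ⟨2, Nat.prime_two⟩) =
        KodairaSymbol.IVstar) →
      ¬ (2 : ℤ) ∣ D.maninConstant ∧
        padicValNat 2 (congruenceNumber D.f) =
          padicValNat 2 D.modularDegree + (padicValNat 2 (W.conductorNorm ℤ) / 2 - 1)

/-- **Candidate E-desc-18 `TameIrreducibleUnitExcess`** (a CONJECTURE of the cell; nothing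
asserted).  Optimal `E`, prime `p ≥ 3` with `v_p(N) = 2`, Kodaira type `II`, `III` or `IV` at `p`,
`E[p]` irreducible ⇒ `v_p(r_E) = v_p(m_E) + 1` (exactly one unit of non-geometric congruence: the
printed ceiling `ord_p(r_E/m_E) ≤ 1` of ARS 2012 Conj. 2.2 is ATTAINED on this stratum).
Census: 335/335 (p ≥ 5: 248/248; p = 3, type III: 87/87 — at `p = 3`, `v₃(N) = 2` only type III
occurs among II/III/IV; N ≤ 3888); refuter-1's independent engine 191/191 (N ≤ 1268). NOT in print;
with ARS 2012 Prop. 2.3 the incidences with `p ∤ m_E` are failures of multiplicity one at the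
irreducible maximal ideal `𝔪_E` of residue characteristic `p`, `p² ∥ N` (ARS exhibit 99A1 and ask
for such computations, p. 5); no multiplicity-one dichotomy by local type at `p² ∥ N` is in print.
[cite: AgasheRibetStein2012, Conj. 2.2 and Prop. 2.3 (ceiling ord_p(r_E/m_E) ≤ 1 at p² ∥ N and the multiplicity-one reading only; the equality on the irreducible II/III/IV stratum is NOT in print — cell bsd-f2-manin MEMO-desc.md §19, E-desc-18; refuter-2 v6 §Q⁶)] -/
@[conjecture] def TameIrreducibleUnitExcess : Prop :=
  ∀ (W : WeierstrassCurve ℚ) [W.IsElliptic] [W.IsGloballyMinimal] [NeZero (W.conductorNorm ℤ)]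
    (D : ModularParametrizationData W (W.conductorNorm ℤ)),
    (∀ z ∈ D.L.lattice, ∃ w ∈ periodLattice D.f, z = D.c * w) →
    (∀ (W' : WeierstrassCurve ℚ) [W'.IsElliptic]
        (D' : ModularParametrizationData W' (W.conductorNorm ℤ)),
        D'.f = D.f → D.modularDegree ≤ D'.modularDegree) →
    ∀ (p : ℕ) (hp : p.Prime), 3 ≤ p → padicValNat p (W.conductorNorm ℤ) = 2 →
      (W.kodairaSymbolAt ((Rat.HeightOneSpectrum.primesEquiv (R := ℤ)).symm ⟨p, hp⟩) =
          KodairaSymbol.II ∨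
        W.kodairaSymbolAt ((Rat.HeightOneSpectrum.primesEquiv (R := ℤ)).symm ⟨p, hp⟩) =
          KodairaSymbol.III ∨
        W.kodairaSymbolAt ((Rat.HeightOneSpectrum.primesEquiv (R := ℤ)).symm ⟨p, hp⟩) =
          KodairaSymbol.IV) →
      W.HasIrreducibleModPGaloisRep p →
      padicValNat p (congruenceNumber D.f) = padicValNat p D.modularDegree + 1

end Summit.BirchSwinnertonDyer.Rank1Residual.ManinAdditive

end
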